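import Summits.CriticalPhenomena.PercolationContinuityZ3.Theorems.SahiMasterFamilyDetector2CoredP3
import Summits.CriticalPhenomena.PercolationContinuityZ3.Theorems.SahiMasterFamilyMinors
import Summits.CriticalPhenomena.PercolationContinuityZ3.Theorems.PercNearOneGluingNoHeavyLowerTailSahiLogDerivEndC3

/-!
# (P3+) reduced to its two rigid classes: terminal triples and common-pivotal face-vanishing triples

Unit `prim-masterthm-p4` (gen 11; crux anchor stmt-CriticalPhenomena-4575, helper work; memo
`run/shared/lean/prim/prim-masterthm/prim-masterthm-p4/FACE-QUOTIENT-3.md`).  (P3+) is gen 10's `SahiE3PositiveSomewhere`: a triple of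
increasing events outside the zero-flag class `Z_3` has `E_3(μ_p) > 0` at SOME interior `p` (it makes the cored `r = 2` detector of the
(EQI-4) endgame unconditional; it is implied by Kahn's Conjecture 5 / Sahi's `C_3`).  Running prim-master-conj's minors induction
(`sahiE3Nonvanishing_of_terminal`) with a POSITIVE conclusion:

* `exists_Ioo_cubic_pos_of_pos_zero/one` — a real cubic positive at an endpoint of `[0,1]` is positive somewhere inside;
* **`exists_sahiE_three_pos_of_sec_pos` (positivity transfer)** — if a minor (`e`-section triple) has `E_3 > 0` at an interior point,
  so does the triple (the fibre cubic `cubicE3` is positive at the corresponding end, hence nearby);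
* an independent pair outside `Z_3` gives `E_3 > 0` at the centre (Harris + strict Harris, tree);
* **`sahiE3PositiveSomewhere_of_terminal_of_commonPivotal`** — (P3+) follows from (P3+) on two rigid classes:
  `SahiE3PositiveOfTerminal` (terminal triples: pairwise dependent, no common pivotal coordinate, all minors in `Z_3` — on paper the
  triangle and the bowties, `E_3 = ∏ p_e(1−p_e) > 0`) and `SahiE3PositiveOfCommonPivotalFaceVanishing` (all minors in `Z_3` and a
  coordinate pivotal for all three events — there `E_3 = ∏ p q · R(p_T)` with `R` multi-affine and decreasing, `FibreCubic`; census: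
  every such triple on `≤ 5` coordinates is tight with `G_I ∈ {1,2}`, memo §3).
HONEST FRAMING: a reduction; (P3+), both class statements, Sahi `C_k` / Kahn's Conjecture 5 and the master theorem remain OPEN
(the class statements are census-exact on `{0,1}^{≤5}`). [this work]
-/

noncomputable section

open scoped Classical

namespace Summit.CriticalPhenomena.PercolationContinuityZ3.Theorems

open Finset Function
open Literature.Combinatorics.Sahi2008
open Literature.Probability.Percolation (DeterminedBy determinedBy_iff)
open Literature.Probability.Percolation.DecisionTree (ind ind_of_mem ind_of_not_mem ind_nonneg)
open SahiLogDerivEnd (derivE3AtZero sahiE_three_ind_update_eq cubicE3_eq_cubic)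

namespace PositiveSomewhere

/-! ### A cubic positive at an end of `[0,1]` is positive inside -/

/-- A real cubic with positive value at `0` is positive at some point of `(0,1)`. [folklore] -/
theorem exists_Ioo_cubic_pos_of_pos_zero (a₀ a₁ a₂ a₃ : ℝ) (h : 0 < a₀) :
    ∃ x : ℝ, x ∈ Set.Ioo (0 : ℝ) 1 ∧ 0 < a₀ + a₁ * x + a₂ * x ^ 2 + a₃ * x ^ 3 := by
  set M : ℝ := |a₁| + |a₂| + |a₃| + 1 with hM
  have hM0 : 0 < M := by positivity
  set x : ℝ := min (1 / 2) (a₀ / (2 * M)) with hx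
  have hx0 : 0 < x := lt_min (by norm_num) (div_pos h (by positivity))
  have hxhalf : x ≤ 1 / 2 := min_le_left _ _
  have hx1 : x < 1 := by linarith
  have hxle : x ≤ a₀ / (2 * M) := min_le_right _ _
  refine ⟨x, ⟨hx0, hx1⟩, ?_⟩
  have hx2 : x ^ 2 ≤ x := by nlinarith
  have hx3 : x ^ 3 ≤ x := by nlinarith
  have hx2n : 0 ≤ x ^ 2 := by positivity
  have hx3n : 0 ≤ x ^ 3 := by positivity
  have h1 : -(|a₁| * x) ≤ a₁ * x := by nlinarith [neg_abs_le a₁]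
  have h2a : -(|a₂| * x ^ 2) ≤ a₂ * x ^ 2 := by nlinarith [neg_abs_le a₂]
  have h2 : -(|a₂| * x) ≤ a₂ * x ^ 2 := by nlinarith [abs_nonneg a₂]
  have h3a : -(|a₃| * x ^ 3) ≤ a₃ * x ^ 3 := by nlinarith [neg_abs_le a₃]
  have h3 : -(|a₃| * x) ≤ a₃ * x ^ 3 := by nlinarith [abs_nonneg a₃]
  have hMx : M * x ≤ a₀ / 2 := by
    have : M * x ≤ M * (a₀ / (2 * M)) := mul_le_mul_of_nonneg_left hxle hM0.le
    have h' : M * (a₀ / (2 * M)) = a₀ / 2 := by field_simp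
    linarith
  nlinarith

/-- A real cubic with positive value at `1` is positive at some point of `(0,1)`. [folklore] -/
theorem exists_Ioo_cubic_pos_of_pos_one (a₀ a₁ a₂ a₃ : ℝ) (h : 0 < a₀ + a₁ + a₂ + a₃) :
    ∃ x : ℝ, x ∈ Set.Ioo (0 : ℝ) 1 ∧ 0 < a₀ + a₁ * x + a₂ * x ^ 2 + a₃ * x ^ 3 := by
  -- reverse the cubic: `t ↦ value at 1 − t`
  obtain ⟨t, ht, hpos⟩ := exists_Ioo_cubic_pos_of_pos_zero (a₀ + a₁ + a₂ + a₃) (-(a₁ + 2 * a₂ + 3 * a₃)) (a₂ + 3 * a₃) (-a₃) h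
  refine ⟨1 - t, ⟨by linarith [ht.2], by linarith [ht.1]⟩, ?_⟩
  have : a₀ + a₁ * (1 - t) + a₂ * (1 - t) ^ 2 + a₃ * (1 - t) ^ 3 =
      (a₀ + a₁ + a₂ + a₃) + -(a₁ + 2 * a₂ + 3 * a₃) * t + (a₂ + 3 * a₃) * t ^ 2 + -a₃ * t ^ 3 := by ring
  rw [this]; exact hpos

/-! ### Positivity transfer from a minor -/

variable {ι : Type} [Fintype ι]

/-- **Positivity transfer.**  If the triple of `e`-sections (`b = true`: contractions, `b = false`: deletions) has `E_3 > 0` at some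
interior parameter, then the triple itself has `E_3 > 0` at some interior parameter: the fibre cubic `s ↦ E_3(μ_{p[e↦s]}; 1_U)` takes
the value `E_3(μ_p; sections)` at the end `s = b`, hence is positive nearby. [this work] -/
theorem exists_sahiE_three_pos_of_sec_pos (U : Fin 3 → Set (Set ι)) (e : ι) (b : Bool)
    (h : ∃ p : ι → unitInterval, (∀ i, (p i : ℝ) ∈ Set.Ioo (0 : ℝ) 1) ∧
      0 < sahiE (bernoulliWeight p) 3 (fun j => ind (secAt e b (U j)))) :
    ∃ p : ι → unitInterval, (∀ i, (p i : ℝ) ∈ Set.Ioo (0 : ℝ) 1) ∧ 0 < sahiE (bernoulliWeight p) 3 (fun j => ind (U j)) := by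
  obtain ⟨p, hp, hpos⟩ := h
  -- the fibre cubic and its value at the end `b`
  set Φ : ℝ → ℝ := cubicE3 p e (ind (U 0)) (ind (U 1)) (ind (U 2)) with hΦ
  have hend : Φ ((boolParam b : unitInterval) : ℝ) = sahiE (bernoulliWeight p) 3 (fun j => ind (secAt e b (U j))) := by
    rw [hΦ, ← sahiE_three_ind_update_eq, sahiE_three_update_boolParam,
      sahiE_three_secAt_update p e b (boolParam b) (p e), update_eq_self]
  obtain ⟨c₂, c₃, hc⟩ := cubicE3_eq_cubic p e (ind (U 0)) (ind (U 1)) (ind (U 2))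
  -- a point of `(0,1)` where the cubic is positive
  have key : ∃ x : ℝ, x ∈ Set.Ioo (0 : ℝ) 1 ∧ 0 < Φ x := by
    cases b
    · have h0 : 0 < Φ 0 := by
        have : ((boolParam false : unitInterval) : ℝ) = 0 := by simp [boolParam]
        rw [← this, hend]; exact hpos
      obtain ⟨x, hx, hx'⟩ := exists_Ioo_cubic_pos_of_pos_zero (Φ 0) (derivE3AtZero p e (ind (U 0)) (ind (U 1)) (ind (U 2))) c₂ c₃ h0
      exact ⟨x, hx, by rw [hΦ, hc x]; exact hx'⟩
    · have h1 : 0 < Φ 1 := by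
        have : ((boolParam true : unitInterval) : ℝ) = 1 := by simp [boolParam]
        rw [← this, hend]; exact hpos
      have h1' : 0 < Φ 0 + derivE3AtZero p e (ind (U 0)) (ind (U 1)) (ind (U 2)) + c₂ + c₃ := by
        have := hc 1; simp only [mul_one, one_pow] at this; rw [← this]; exact h1
      obtain ⟨x, hx, hx'⟩ := exists_Ioo_cubic_pos_of_pos_one (Φ 0) (derivE3AtZero p e (ind (U 0)) (ind (U 1)) (ind (U 2))) c₂ c₃ h1'
      exact ⟨x, hx, by rw [hΦ, hc x]; exact hx'⟩
  obtain ⟨x, hx, hxpos⟩ := key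
  refine ⟨update p e ⟨x, hx.1.le, hx.2.le⟩, update_mem_Ioo hp e hx, ?_⟩
  rw [sahiE_three_ind_update_eq]
  exact hxpos

/-- **An independent pair outside `Z_3` gives `E_3 > 0` at the centre of the cube**: for increasing events, `E_3 ≥ 0` when two of the
three events are determined by disjoint coordinate sets (tree: two Harris terms), and `= 0` there iff the triple is a zero flag. [this work] -/
theorem sahiE_three_pos_half_of_indepPair (U : Fin 3 → Set (Set ι)) (hU : ∀ j, IsUpperSet (U j)) (m : Fin 3)
    (hZ2 : SuppZeroFlag 2 (fun j => U (m.succAbove j))) (hZ3 : ¬ SuppZeroFlag 3 U) :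
    0 < sahiE (bernoulliWeight (halfParams ι)) 3 (fun j => ind (U j)) := by
  refine lt_of_le_of_ne (sahiE_three_ind_nonneg_of_indepPair (halfParams ι) U hU m hZ2) fun h0 => hZ3 ?_
  exact (sahiE_three_ind_eq_zero_iff_of_indepPair (halfParams ι) (halfParams_mem_Ioo ι) U hU m hZ2).1 h0.symm

/-! ### The two rigid classes -/

/-- **(P3+) on the terminal class** (a statement; census-exact, and PROVED ON PAPER via prim-master-conj's classification "terminal
= triangle ∪ bowties, `E_3 = ∏_e p_e(1−p_e)`" — STRUCTURE-PROOF.md §11–§13 — whose Lean form `SahiMasterFamilyTerminal` concludes only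
`E_3 ≠ 0`; never a fact): every terminal triple of increasing events has `E_3(μ_p) > 0` for some interior `p`. [this work]
[status: proved on paper, Lean open] -/
@[conjecture] def SahiE3PositiveOfTerminal : Prop :=
  ∀ (ι : Type) [Fintype ι] (U : Fin 3 → Set (Set ι)) (S : Finset ι),
    (∀ j, IsUpperSet (U j)) → (∀ j, DeterminedBy (U j) (↑S : Set ι)) → TerminalTriple U S →
      ∃ p : ι → unitInterval, (∀ e, (p e : ℝ) ∈ Set.Ioo (0 : ℝ) 1) ∧
        0 < sahiE (bernoulliWeight p) 3 (fun j => ind (U j))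

/-- **(P3+) on the common-pivotal face-vanishing class** (OUR CONJECTURE; a statement, never a fact): a triple of increasing events
determined by `S`, all of whose minors at coordinates of `S` are zero flags, with a coordinate pivotal for all three events, has
`E_3(μ_p) > 0` for some interior `p`.  There `E_3 = ∏_e p_e(1−p_e) · R(p_T)` with `R` multi-affine in the common-pivotal coordinates
and decreasing in each (`FibreCubic`); the statement is `R(0_T) = G_I ≥ 1`.  Census (memo §3): on `{0,1}^{≤5}` every such triple is
TIGHT (`⋂ U_j = {⊤}`), hence `G_I = Λ ≥ 1` by the principal-cap dichotomy; the class is {a cylinder member whose core contains `T`}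
∪ {`(AND(S_i)·OR(Sᶜ_i))_{i=1,2,3}`, `S_1 ⊔ S_2 ⊔ S_3 = I`} ∪ {`(AND(I), OR(I), OR(I))`}. [this work] [status: open; census-exact n ≤ 5] -/
@[conjecture] def SahiE3PositiveOfCommonPivotalFaceVanishing : Prop :=
  ∀ (ι : Type) [Fintype ι] (U : Fin 3 → Set (Set ι)) (S : Finset ι),
    (∀ j, IsUpperSet (U j)) → (∀ j, DeterminedBy (U j) (↑S : Set ι)) →
      (∃ e : ι, ∀ j, ∃ ω, e ∉ ω ∧ ω ∉ U j ∧ insert e ω ∈ U j) →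
        (∀ e ∈ S, ∀ b : Bool, SuppZeroFlag 3 (fun j => secAt e b (U j))) →
          ∃ p : ι → unitInterval, (∀ e, (p e : ℝ) ∈ Set.Ioo (0 : ℝ) 1) ∧
            0 < sahiE (bernoulliWeight p) 3 (fun j => ind (U j))

/-! ### The reduction -/

/-- **(P3+) for pairwise-dependent triples from the two rigid classes** (induction on a determining set through minors; a minor
outside `Z_3` is pairwise dependent — induction — or has an independent pair — centre of the cube — and its positivity transfers;
if all minors are zero flags the triple is in one of the two classes). [this work] -/
theorem exists_sahiE_three_pos_of_pairwiseDependent (hT : SahiE3PositiveOfTerminal)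
    (hV : SahiE3PositiveOfCommonPivotalFaceVanishing) :
    ∀ (n : ℕ) (ι : Type) [Fintype ι] (U : Fin 3 → Set (Set ι)) (S : Finset ι), S.card = n →
      (∀ j, IsUpperSet (U j)) → (∀ j, DeterminedBy (U j) (↑S : Set ι)) → PairwiseDependent U →
        ∃ p : ι → unitInterval, (∀ e, (p e : ℝ) ∈ Set.Ioo (0 : ℝ) 1) ∧
          0 < sahiE (bernoulliWeight p) 3 (fun j => ind (U j)) := by
  -- the face-vanishing case, uniform in `n`
  have fv_case : ∀ (ι : Type) [Fintype ι] (U : Fin 3 → Set (Set ι)) (S : Finset ι),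
      (∀ j, IsUpperSet (U j)) → (∀ j, DeterminedBy (U j) (↑S : Set ι)) → PairwiseDependent U →
        (∀ e ∈ S, ∀ b : Bool, SuppZeroFlag 3 (fun j => secAt e b (U j))) →
          ∃ p : ι → unitInterval, (∀ e, (p e : ℝ) ∈ Set.Ioo (0 : ℝ) 1) ∧
            0 < sahiE (bernoulliWeight p) 3 (fun j => ind (U j)) := by
    intro ι _ U S hU hUS hPD hfv
    by_cases hc : ∃ e : ι, ∀ j, ∃ ω, e ∉ ω ∧ ω ∉ U j ∧ insert e ω ∈ U j
    · exact hV ι U S hU hUS hc hfv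
    · exact hT ι U S hU hUS ⟨hPD, hc, hfv⟩
  intro n
  induction n with
  | zero =>
    intro ι _ U S hS hU hUS hPD
    refine fv_case ι U S hU hUS hPD fun e he => ?_
    rw [Finset.card_eq_zero.1 hS] at he
    exact absurd he (Finset.notMem_empty e)
  | succ n ih =>
    intro ι _ U S hS hU hUS hPD
    by_cases hmin : ∃ e ∈ S, ∃ b : Bool, ¬ SuppZeroFlag 3 (fun j => secAt e b (U j))
    · obtain ⟨e, heS, b, hZ⟩ := hmin
      set V : Fin 3 → Set (Set ι) := fun j => secAt e b (U j) with hV'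
      have hVup : ∀ j, IsUpperSet (V j) := fun j => isUpperSet_secAt e b (hU j)
      have hVdet : ∀ j, DeterminedBy (V j) (↑(S.erase e) : Set ι) := fun j => determinedBy_secAt e b (hUS j)
      have hcard : (S.erase e).card = n := by rw [Finset.card_erase_of_mem heS, hS]; rfl
      refine exists_sahiE_three_pos_of_sec_pos U e b ?_
      by_cases hVPD : PairwiseDependent V
      · exact ih ι V (S.erase e) hcard hVup hVdet hVPD
      · simp only [PairwiseDependent, not_forall, not_not] at hVPD
        obtain ⟨m, hm⟩ := hVPD
        exact ⟨halfParams ι, halfParams_mem_Ioo ι, sahiE_three_pos_half_of_indepPair V hVup m hm hZ⟩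
    · push Not at hmin
      exact fv_case ι U S hU hUS hPD hmin

/-- **(P3+) from its two rigid classes.**  If every terminal triple and every common-pivotal face-vanishing triple of increasing events has
`E_3(μ_p) > 0` at some interior `p`, then so does EVERY triple of increasing events outside `Z_3` (`SahiE3PositiveSomewhere`). [this work] -/
theorem sahiE3PositiveSomewhere_of_terminal_of_commonPivotal (hT : SahiE3PositiveOfTerminal)
    (hV : SahiE3PositiveOfCommonPivotalFaceVanishing) : SahiE3PositiveSomewhere := by
  intro ι _ U hU hZ
  by_cases hPD : PairwiseDependent U
  · have hdet : ∀ j, DeterminedBy (U j) (↑(Finset.univ : Finset ι) : Set ι) := by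
      intro j
      rw [determinedBy_iff]
      intro ω ω' h
      simp only [Finset.coe_univ, Set.inter_univ] at h
      rw [h]
    exact exists_sahiE_three_pos_of_pairwiseDependent hT hV _ ι U Finset.univ rfl hU hdet hPD
  · simp only [PairwiseDependent, not_forall, not_not] at hPD
    obtain ⟨m, hm⟩ := hPD
    exact ⟨halfParams ι, halfParams_mem_Ioo ι, sahiE_three_pos_half_of_indepPair U hU m hm hZ⟩

end PositiveSomewhere

end Summit.CriticalPhenomena.PercolationContinuityZ3.Theorems
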